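import Summits.Ventures.HSemireg.WedgeHankelRecurrenceGaussChainSequenceConstant

/-!
# Venture HSemireg — **THE GAUSS–CHEBYSHEV RULE OF THE SECOND KIND IN THE CHAPTER'S FORMAT**: for the recurrence `a ≡ 0`, `b ≡ 1∕4` (`q_n = 2^{−n} U_n`, N360) the Favard ∕ Christoffel weight at
# the node `x = cos θ`, `θ = (m+1)π∕(t+2)` (`m ≤ t`) is **`b_1⋯b_t ∕ (q'_{t+1}(x) q_t(x)) = 2 sin²θ ∕ (t + 2)`** — via the Christoffel–Darboux form `q'_{t+1} q_t = Σ_j 4^{−(t−j)} q_j²` (N280) and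
# the trigonometric sum **`Σ_{j=1}^{t+1} sin²(jθ) = (t+2)∕2`** (Lagrange's identity `2 sin θ Σ_{j ≤ N} cos(2jθ) = sin((2N+1)θ) − sin θ`)

HONEST FRAMING. Part of the Lean index of the computation cell `pub-hsemireg` (seat p10 gen 46, Sunday typer «UNIFORM-IN-n»).  Finite trigonometric sums and Mathlib's Chebyshev `U` only; no
variety, no cohomology theory, no sheaf, no Ext group and no semiregularity map is constructed here; nothing here says that HC / HC_CM / HC_AV holds; no Literature fact (unproved `Prop`) is declared
or used.  Custodian versions as in `WedgeHankelSiegelIdeal` (1/3).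
SOURCES (cited).  G. Szegő, *Orthogonal Polynomials*, (15.3.10) ∕ §15.3 (Gauss–Chebyshev of the second kind: nodes `cos(kπ∕(n+1))`, weights `π∕(n+1) · sin²(kπ∕(n+1))`); M. Abramowitz,
I. Stegun, *Handbook*, 25.4.40; P. J. Davis, P. Rabinowitz, *Methods of Numerical Integration* (1984), §2.7 (2.7.1.15); W. Gautschi, *Orthogonal Polynomials* (2004), Table 1.1, Ex. 1.13.
PROOF TYPED HERE.  `2 sin θ cos(2jθ) = sin((2j+1)θ) − sin((2j−1)θ)` telescopes; at `θ = (m+1)π∕(t+2)`, `(2t+3)θ = (m+1)·2π − θ`, so `Σ_{j=1}^{t+1} cos(2jθ) = −1` and `Σ sin² = (t+2)∕2`;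
`q_j(cos θ) = 2^{−j} sin((j+1)θ)∕sin θ` (N360 + Mathlib `U_real_cos`), `Π_{l=j+1}^{t} b_l = 4^{−(t−j)}`, N280 `recurrence_cd_diag_eq_derivative_mul`.
DEDUP DISCLOSURE (`rg -n 'sin .* \\^ 2 / |chebyshevU_favard|sum_sin_sq' Summits/Ventures/HSemireg`, 2026-09-03): N342 typed the FIRST-kind weights (all equal to `1∕(m+1)`); N360 the second-kind
nodes only.  The 4 names below: 0 hits tree-wide.

WHAT IS IN THE TREE.  N360 `chebyshevU_recurrence_eq_U`; N280 `recurrence_cd_diag_eq_derivative_mul`; Mathlib `Polynomial.Chebyshev.U_real_cos`, `Real.sin_nat_mul_two_pi_sub`,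
`Real.sin_sq_eq_half_sub`, `Real.sin_nat_mul_pi`.
THIS FILE (namespace `Summit.Ventures.HSemireg.Wedge.HankelOuter` continued; CHAINED on N383 (import only); 0 definitions):
* §1149 `two_sin_mul_sum_cos_even` (Lagrange's identity), **`sum_sin_sq_at_node`** (`Σ_{j ≤ t} sin²((j+1)θ) = (t+2)∕2` at `θ = (m+1)π∕(t+2)`), `chebyshevU_recurrence_eval_cos`
  (`q_j(cos θ) sin θ = 2^{−j} sin((j+1)θ)`), **`chebyshevU_favard_weight`** (the weight `2 sin²θ∕(t+2)`).
CAVEATS.  The chapter's discrete (Favard, total mass `1`) normalisation: the classical weights `π∕(n+1) sin²` for `∫ f √(1−x²) dx` are these times `π∕2`.  Nothing Ext-side.  New names only.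
-/

open Module Polynomial Real
open scoped Matrix Polynomial

namespace Summit.Ventures.HSemireg.Wedge.HankelOuter

/-! ## §1149. Gauss–Chebyshev weights of the second kind -/

/-- **Lagrange: `2 sin θ · Σ_{j<N} cos(2(j+1)θ) = sin((2N+1)θ) − sin θ`.** [this file, §1149] -/
theorem two_sin_mul_sum_cos_even (θ : ℝ) (N : ℕ) : 2 * sin θ * ∑ j ∈ Finset.range N, cos (2 * ((j : ℝ) + 1) * θ) = sin ((2 * N + 1) * θ) - sin θ := by
  induction N with
  | zero => simp
  | succ N ih =>
    rw [Finset.sum_range_succ, mul_add, ih]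
    have h1 : sin ((2 * ((N + 1 : ℕ) : ℝ) + 1) * θ) = sin (2 * ((N : ℝ) + 1) * θ + θ) := by push_cast; ring_nf
    have h2 : sin ((2 * (N : ℝ) + 1) * θ) = sin (2 * ((N : ℝ) + 1) * θ - θ) := by ring_nf
    rw [h1, h2, sin_add, sin_sub]
    ring

/-- **`Σ_{j ≤ t} sin²((j+1)θ) = (t+2)∕2` at `θ = (m+1)π∕(t+2)`, `m ≤ t`.** [Szegő §15.3; this file, §1149] -/
theorem sum_sin_sq_at_node (t m : ℕ) (hm : m ≤ t) :
    ∑ j ∈ Finset.range (t + 1), sin (((j : ℝ) + 1) * (((m : ℝ) + 1) * π / ((t : ℝ) + 2))) ^ 2 = ((t : ℝ) + 2) / 2 := by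
  have hθpos : 0 < ((m : ℝ) + 1) * π / ((t : ℝ) + 2) := by positivity
  have hθlt : ((m : ℝ) + 1) * π / ((t : ℝ) + 2) < π := by
    rw [div_lt_iff₀ (by positivity)]; have : (m : ℝ) ≤ t := (by exact_mod_cast hm); nlinarith [pi_pos]
  have hsin : sin (((m : ℝ) + 1) * π / ((t : ℝ) + 2)) ≠ 0 := (sin_pos_of_pos_of_lt_pi hθpos hθlt).ne'
  -- the cosine sum is `−1`
  have hL := two_sin_mul_sum_cos_even (((m : ℝ) + 1) * π / ((t : ℝ) + 2)) (t + 1)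
  have htop : sin ((2 * ((t + 1 : ℕ) : ℝ) + 1) * (((m : ℝ) + 1) * π / ((t : ℝ) + 2))) = -sin (((m : ℝ) + 1) * π / ((t : ℝ) + 2)) := by
    rw [← sin_nat_mul_two_pi_sub _ (m + 1)]
    congr 1
    push_cast
    field_simp
    ring
  rw [htop] at hL
  have hcos : ∑ j ∈ Finset.range (t + 1), cos (2 * ((j : ℝ) + 1) * (((m : ℝ) + 1) * π / ((t : ℝ) + 2))) = -1 := by
    have h2 : 2 * sin (((m : ℝ) + 1) * π / ((t : ℝ) + 2)) ≠ 0 := mul_ne_zero two_ne_zero hsin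
    apply mul_left_cancel₀ h2
    rw [hL]; ring
  have hsq : ∀ j : ℕ, sin (((j : ℝ) + 1) * (((m : ℝ) + 1) * π / ((t : ℝ) + 2))) ^ 2 = 1 / 2 - cos (2 * ((j : ℝ) + 1) * (((m : ℝ) + 1) * π / ((t : ℝ) + 2))) / 2 := fun j => by
    rw [sin_sq_eq_half_sub]; ring_nf
  simp_rw [hsq, Finset.sum_sub_distrib, ← Finset.sum_div, hcos, Finset.sum_const, Finset.card_range]
  simp only [nsmul_eq_mul]
  push_cast
  ring

/-- **`q_j(cos θ) · sin θ = 2^{−j} sin((j+1)θ)`** for the second-kind recurrence `a ≡ 0`, `b ≡ 1∕4`. [N360; Mathlib `U_real_cos`; this file, §1149] -/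
theorem chebyshevU_recurrence_eval_cos {q : ℕ → ℝ[X]} {a b : ℕ → ℝ} (hq0 : q 0 = 1) (hq1 : q 1 = Polynomial.X - C (a 0))
    (hrec : ∀ n, q (n + 2) = (Polynomial.X - C (a (n + 1))) * q (n + 1) - C (b (n + 1)) * q n) (ha : ∀ n, a n = 0) (hb : ∀ n, b (n + 1) = 1 / 4) (j : ℕ) (θ : ℝ) :
    (q j).eval (cos θ) * sin θ = (1 / 2 : ℝ) ^ j * sin (((j : ℝ) + 1) * θ) := by
  rw [chebyshevU_recurrence_eq_U hq0 hq1 hrec ha hb j, eval_mul, eval_C, mul_assoc, Polynomial.Chebyshev.U_real_cos]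
  push_cast
  ring_nf

/-- **THE SECOND-KIND GAUSS–CHEBYSHEV WEIGHT: `b_1⋯b_t ∕ (q'_{t+1}(x) q_t(x)) = 2 sin²θ ∕ (t+2)` at `x = cos θ`, `θ = (m+1)π∕(t+2)`, `m ≤ t`.** [Szegő (15.3.10); Abramowitz–Stegun 25.4.40; this file,
§1149] -/
theorem chebyshevU_favard_weight {q : ℕ → ℝ[X]} {a b : ℕ → ℝ} (hq0 : q 0 = 1) (hq1 : q 1 = Polynomial.X - C (a 0))
    (hrec : ∀ n, q (n + 2) = (Polynomial.X - C (a (n + 1))) * q (n + 1) - C (b (n + 1)) * q n) (ha : ∀ n, a n = 0) (hb : ∀ n, b (n + 1) = 1 / 4) {t m : ℕ} (hm : m ≤ t) :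
    (∏ l ∈ Finset.Ico 1 (t + 1), b l) / ((derivative (q (t + 1))).eval (cos (((m : ℝ) + 1) * π / ((t : ℝ) + 2))) * (q t).eval (cos (((m : ℝ) + 1) * π / ((t : ℝ) + 2)))) =
      2 * sin (((m : ℝ) + 1) * π / ((t : ℝ) + 2)) ^ 2 / ((t : ℝ) + 2) := by
  have hθpos : 0 < ((m : ℝ) + 1) * π / ((t : ℝ) + 2) := by positivity
  have hθlt : ((m : ℝ) + 1) * π / ((t : ℝ) + 2) < π := by
    rw [div_lt_iff₀ (by positivity)]; have : (m : ℝ) ≤ t := (by exact_mod_cast hm); nlinarith [pi_pos]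
  have hsin : sin (((m : ℝ) + 1) * π / ((t : ℝ) + 2)) ≠ 0 := (sin_pos_of_pos_of_lt_pi hθpos hθlt).ne'
  -- `q_{t+1}(cos θ) = 0`
  have hzero : (q (t + 1)).eval (cos (((m : ℝ) + 1) * π / ((t : ℝ) + 2))) = 0 := by
    have h := chebyshevU_recurrence_eval_cos hq0 hq1 hrec ha hb (t + 1) (((m : ℝ) + 1) * π / ((t : ℝ) + 2))
    have hs : sin ((((t + 1 : ℕ) : ℝ) + 1) * (((m : ℝ) + 1) * π / ((t : ℝ) + 2))) = 0 := by
      rw [show (((t + 1 : ℕ) : ℝ) + 1) * (((m : ℝ) + 1) * π / ((t : ℝ) + 2)) = ((m + 1 : ℕ) : ℝ) * π by push_cast; field_simp; ring]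
      exact sin_nat_mul_pi (m + 1)
    rw [hs, mul_zero] at h
    exact (mul_eq_zero.1 h).resolve_right hsin
  -- products of `b`
  have hbv : ∀ l, 1 ≤ l → b l = 1 / 4 := fun l hl => by obtain ⟨k, rfl⟩ : ∃ k, l = k + 1 := ⟨l - 1, by omega⟩; exact hb k
  have hprod : ∀ i j : ℕ, 1 ≤ i → ∏ l ∈ Finset.Ico i j, b l = (1 / 4 : ℝ) ^ (j - i) := fun i j hi => by
    rw [Finset.prod_congr rfl fun l hl => hbv l (le_trans hi (Finset.mem_Ico.1 hl).1), Finset.prod_const, Nat.card_Ico]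
  rw [← recurrence_cd_diag_eq_derivative_mul hq0 hq1 hrec t hzero, hprod 1 (t + 1) le_rfl, Nat.add_sub_cancel]
  -- each term of the CD sum times `sin²θ` is `4^{−t} sin²((j+1)θ)`
  have hterm : ∀ j ∈ Finset.range (t + 1), (∏ l ∈ Finset.Ico (j + 1) (t + 1), b l) * ((q j).eval (cos (((m : ℝ) + 1) * π / ((t : ℝ) + 2))) *
      (q j).eval (cos (((m : ℝ) + 1) * π / ((t : ℝ) + 2)))) * sin (((m : ℝ) + 1) * π / ((t : ℝ) + 2)) ^ 2 =
      (1 / 4 : ℝ) ^ t * sin (((j : ℝ) + 1) * (((m : ℝ) + 1) * π / ((t : ℝ) + 2))) ^ 2 := fun j hj => by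
    have hjt : j ≤ t := Nat.lt_succ_iff.1 (Finset.mem_range.1 hj)
    have hq := chebyshevU_recurrence_eval_cos hq0 hq1 hrec ha hb j (((m : ℝ) + 1) * π / ((t : ℝ) + 2))
    rw [hprod (j + 1) (t + 1) (by omega), show t + 1 - (j + 1) = t - j by omega]
    calc (1 / 4 : ℝ) ^ (t - j) * ((q j).eval (cos (((m : ℝ) + 1) * π / ((t : ℝ) + 2))) * (q j).eval (cos (((m : ℝ) + 1) * π / ((t : ℝ) + 2)))) *
          sin (((m : ℝ) + 1) * π / ((t : ℝ) + 2)) ^ 2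
        = (1 / 4 : ℝ) ^ (t - j) * ((q j).eval (cos (((m : ℝ) + 1) * π / ((t : ℝ) + 2))) * sin (((m : ℝ) + 1) * π / ((t : ℝ) + 2))) ^ 2 := by ring
      _ = (1 / 4 : ℝ) ^ (t - j) * ((1 / 2 : ℝ) ^ j) ^ 2 * sin (((j : ℝ) + 1) * (((m : ℝ) + 1) * π / ((t : ℝ) + 2))) ^ 2 := by rw [hq]; ring
      _ = (1 / 4 : ℝ) ^ t * sin (((j : ℝ) + 1) * (((m : ℝ) + 1) * π / ((t : ℝ) + 2))) ^ 2 := by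
          rw [show (((1 : ℝ) / 2) ^ j) ^ 2 = (1 / 4) ^ j by rw [← pow_mul, mul_comm, pow_mul]; norm_num, ← pow_add, Nat.sub_add_cancel hjt]
  have hsum : (∑ j ∈ Finset.range (t + 1), (∏ l ∈ Finset.Ico (j + 1) (t + 1), b l) * ((q j).eval (cos (((m : ℝ) + 1) * π / ((t : ℝ) + 2))) *
      (q j).eval (cos (((m : ℝ) + 1) * π / ((t : ℝ) + 2))))) * sin (((m : ℝ) + 1) * π / ((t : ℝ) + 2)) ^ 2 = (1 / 4 : ℝ) ^ t * (((t : ℝ) + 2) / 2) := by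
    rw [Finset.sum_mul, Finset.sum_congr rfl hterm, ← Finset.mul_sum, sum_sin_sq_at_node t m hm]
  have hS : ∑ j ∈ Finset.range (t + 1), (∏ l ∈ Finset.Ico (j + 1) (t + 1), b l) * ((q j).eval (cos (((m : ℝ) + 1) * π / ((t : ℝ) + 2))) *
      (q j).eval (cos (((m : ℝ) + 1) * π / ((t : ℝ) + 2)))) = (1 / 4 : ℝ) ^ t * (((t : ℝ) + 2) / 2) / sin (((m : ℝ) + 1) * π / ((t : ℝ) + 2)) ^ 2 := by
    rw [eq_div_iff (pow_ne_zero 2 hsin), hsum]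
  rw [hS]
  have h4 : (1 / 4 : ℝ) ^ t ≠ 0 := pow_ne_zero _ (by norm_num)
  field_simp

end Summit.Ventures.HSemireg.Wedge.HankelOuter
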